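import Mathlib
import Summits.Ventures.PercRepro2.CrossAPrimeTwoRoutesTools
import Summits.Ventures.PercRepro2.CrossAPrimeAvoidCrux

/-!
# The route-unique class: the sign of `crossA′so` when `G − a₂` has exactly one `a₁`–`v` path
(blind cell PercRepro2, p5 g35; S4 §2.4 (s) addendum 31 (1) in the kernel)

If on `Q = {a₂ ↮ a₁}` the connection `a₁ ↔ v` is exactly «the path `π` is open» (`hroute`), with
`π` living on `insert a₁ V` and connecting `a₁` to all of `V ∋ v` when open, then every route mass
is `p_π` times the corresponding `Q_V`-mass (`prob_Q_conn_allOpen`, `prob_Q_conn_conn_allOpen`),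
`c = p_π ≤ π` is admissible, and `crossC(p_π) = p_π · PHI(V) ≥ 0` by the set-avoidance theorem
`CrossAPrimeAvoidCrux.avoid_crux_nonneg` (**`crossA'so_nonneg_of_oneRoute`**).
Own work; standard axioms.
-/

namespace Summit.Ventures.PercRepro2

open LeafRowPendantRootSO CrossAPrimeA2Route CrossAPrimeTwoRoutes

namespace CrossAPrimeOneRoute

variable {V : Type*} {E : Type*} [Fintype E] [DecidableEq E] [Fintype V] [DecidableEq V]
  {R : Type*} [Field R] [LinearOrder R] [IsStrictOrderedRing R]
variable {ends : E → Sym2 V}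

/-- **The route-unique class**: `0 ≤ crossA′so` when, on `Q`, `a₁ ↔ v` iff the path `π` is open. -/
theorem crossA'so_nonneg_of_oneRoute (p : E → R) (hp : IsProbVec p) {π : Finset E}
    {W : Finset V} {o a₁ a₂ v b : V}
    (hπ : ∀ e ∈ π, ∀ x, x ∈ ends e → x = a₁ ∨ x ∈ W)
    (hconn : ∀ ω ∈ allOpen π, ∀ x ∈ W, Conn ends ω a₁ x) (hv : v ∈ W)
    (hroute : ∀ ω ∈ avoidAll ends a₂ {a₁}, ω ∈ connEvent ends a₁ v ↔ ω ∈ allOpen π) :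
    0 ≤ crossA'so p ends o a₁ a₂ v b := by
  classical
  set q := ∏ e ∈ π, p e with hqdef
  have hq0 : 0 ≤ q := Finset.prod_nonneg fun e _ => hp.nonneg e
  -- `c = p_π ≤ π`
  have hc : q ≤ prob p (connEvent ends a₁ v) := by
    rw [hqdef, ← prob_allOpen p π]
    exact prob_mono hp fun ω hω => hconn ω hω v hv
  refine crossA'so_nonneg_of_crossC hp o a₁ a₂ v b hc ?_
  set Q := avoidAll ends a₂ {a₁} with hQ
  set L := connEvent ends a₁ v
  have hred : ∀ A : Set (Config E), Q ∩ (L ∩ A) = Q ∩ A ∩ allOpen π := by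
    intro A
    ext ω
    simp only [Set.mem_inter_iff]
    constructor
    · rintro ⟨hQω, hL, hA⟩
      exact ⟨⟨hQω, hA⟩, (hroute ω hQω).1 hL⟩
    · rintro ⟨⟨hQω, hA⟩, hπ'⟩
      exact ⟨hQω, (hroute ω hQω).2 hπ', hA⟩
  have hxv : prob p (Q ∩ (L ∩ connEvent ends a₂ o)) =
      q * prob p (avoidAll ends a₂ (insert a₁ W) ∩ connEvent ends a₂ o) := by
    rw [hred]; exact prob_Q_conn_allOpen p hπ hconn a₂ o
  have hyv : prob p (Q ∩ (L ∩ connEvent ends a₂ b)) =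
      q * prob p (avoidAll ends a₂ (insert a₁ W) ∩ connEvent ends a₂ b) := by
    rw [hred]; exact prob_Q_conn_allOpen p hπ hconn a₂ b
  have hDv : prob p (Q ∩ (L ∩ (connEvent ends a₂ o ∩ connEvent ends a₂ b))) =
      q * prob p (avoidAll ends a₂ (insert a₁ W) ∩ (connEvent ends a₂ o ∩ connEvent ends a₂ b)) := by
    rw [hred]; exact prob_Q_conn_conn_allOpen p hπ hconn a₂ o b
  have hPHI := CrossAPrimeAvoidCrux.avoid_crux_nonneg p hp ends o a₁ a₂ b W
  unfold crossC
  rw [hxv, hyv, hDv]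
  nlinarith [mul_nonneg hq0 hPHI]

end CrossAPrimeOneRoute

end Summit.Ventures.PercRepro2
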